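import Summits.AtomisticToContinuum.Crystallization.Theorems.RepetitiveNetworkReductionRecurrentMemberDefs

/-!
# `NetworkRecurrenceTransfer.stub_evaporationLaw` — part 1/3: uniform recurrence passes to rooted local limits

Registered stub `stub_evaporationLaw` of `NetworkRecurrenceTransfer` (RED, `stmt-AtomisticToContinuum-27236`, route
`RepetitiveNetworkReduction`, sub-problem `Crystallization` of `AtomisticToContinuum`), written by the decomp-a2c cell's
lens-2 g18 seat. This part is pure metric geometry of point sets `S ⊆ ℝ³` in the two-way local matching language
`BallMatch` of `Literature/…/MuGroundStateConfiguration`: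

* `ballMatch_trans` — composition of two-way matchings (tolerances add, the radius shrinks by the tolerances);
* `urs_patch` — rooted uniform recurrence `URS S` (the route's `let UR`) makes the `R`-patch of `S` about ANY fixed point
  `a ∈ S` recur with bounded gaps (gauge depending on `a`);
* `urs_uniform` — for a separated `S`, the gauge can be taken UNIFORM in the centre `a ∈ S` (compactness of separated point
  sets in the local matching topology, `exists_subseq_forall_eventually_ballMatch`, and a contradiction argument);
* `urs_of_limit` — if `S` is separated and uniformly recurrent and the re-rootings `S − c k` (`c k ∈ S`) converge locally to
  `Z`, then `Z` is uniformly recurrent (`URS Z`).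

All statements are folklore (repetitivity is inherited by every member of the hull of a repetitive Delone set,
Baake–Grimm 2013 §5.3 / Lagarias–Pleasants 2003 §2, here in the rooted two-way matching form the route uses). No new
definitions.
-/

open scoped BigOperators Topology
open Filter Set Metric

namespace Summit.AtomisticToContinuum.Crystallization.Theorems.RepetitiveNetworkReductionEvaporationLaw

open Literature.MathematicalPhysics.StatisticalMechanics
open Summit.AtomisticToContinuum.Crystallization.Theorems.RepetitiveNetworkReductionRecurrentMember

/-! ## Matching calculus -/

/-- Four-term triangle inequality. [folklore] -/
theorem norm_add₄_le (a b c d : EuclideanSpace ℝ (Fin 3)) : ‖a + b + c + d‖ ≤ ‖a‖ + ‖b‖ + ‖c‖ + ‖d‖ := by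
  linarith [norm_add_le (a + b + c) d, norm_add_le (a + b) c, norm_add_le a b]

/-- Composition of rooted two-way matchings: `A ~(δ₁,R₁) B` and `B ~(δ₂,R₂) C` give `A ~(δ₁+δ₂,R) C` whenever
`R + δ₂ ≤ R₁` and `R + δ₁ ≤ R₂`. [folklore] -/
theorem ballMatch_trans {A B C : Set (EuclideanSpace ℝ (Fin 3))} {δ₁ δ₂ R R₁ R₂ : ℝ}
    (h₁ : BallMatch δ₁ R₁ 0 A B) (h₂ : BallMatch δ₂ R₂ 0 B C) (hR₁ : R + δ₂ ≤ R₁) (hR₂ : R + δ₁ ≤ R₂)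
    (hδ₁ : 0 ≤ δ₁) (hδ₂ : 0 ≤ δ₂) : BallMatch (δ₁ + δ₂) R 0 A C := by
  constructor
  · intro s hs hsR
    obtain ⟨b, hb, hbs⟩ := h₂.1 s hs (by linarith)
    have hb0 : dist b 0 ≤ R₁ := by linarith [dist_triangle b s 0]
    obtain ⟨a, ha, hab⟩ := h₁.1 b hb hb0
    exact ⟨a, ha, by linarith [dist_triangle a b s]⟩
  · intro a ha haR
    obtain ⟨b, hb, hab⟩ := h₁.2 a ha (by linarith)
    have hb0 : dist b 0 ≤ R₂ := by linarith [dist_triangle b a 0, dist_comm a b]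
    obtain ⟨c, hc, hbc⟩ := h₂.2 b hb hb0
    exact ⟨c, hc, by linarith [dist_triangle a b c]⟩

/-- Translates of a separated set are separated. [folklore] -/
theorem sep_image_sub {δ : ℝ} {S : Set (EuclideanSpace ℝ (Fin 3))}
    (hsep : ∀ p ∈ S, ∀ q ∈ S, p ≠ q → δ ≤ dist p q) (c : EuclideanSpace ℝ (Fin 3)) :
    ∀ p ∈ (fun x => x - c) '' S, ∀ q ∈ (fun x => x - c) '' S, p ≠ q → δ ≤ dist p q := by
  rintro _ ⟨p, hp, rfl⟩ _ ⟨q, hq, rfl⟩ hne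
  rw [dist_sub_right]
  exact hsep p hp q hq fun h => hne (by rw [h])

/-! ## Recurrence of the patch about a fixed point -/

/-- Under `URS S`, the `R`-patch of `S` about any fixed `a ∈ S` recurs with bounded gaps: near every `w ∈ S` there is
`g ∈ S` with `S − g` two-way `(ε, R)`-matched to `S − a`. [folklore] -/
theorem urs_patch {S : Set (EuclideanSpace ℝ (Fin 3))} (hU : URS S) {a : EuclideanSpace ℝ (Fin 3)} (ha : a ∈ S)
    (R ε : ℝ) (hR : 0 ≤ R) (hε : 0 < ε) :
    ∃ G : ℝ, ∀ w ∈ S, ∃ g ∈ S, dist g w ≤ G ∧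
      BallMatch ε R 0 ((fun p => p - g) '' S) ((fun p => p - a) '' S) := by
  obtain ⟨G, hG⟩ := hU (dist a 0 + R + ε) (ε / 2) (by positivity)
  refine ⟨G + dist a 0 + ε, fun w hw => ?_⟩
  obtain ⟨g, hg, hgw, h1, h2⟩ := hG w hw
  obtain ⟨g₁, hg₁, hg₁a⟩ := h1 a ha (by linarith)
  have e0 : ‖g₁ - g - a‖ ≤ ε / 2 := by rwa [← dist_eq_norm]
  refine ⟨g₁, hg₁, ?_, ?_, ?_⟩
  · calc dist g₁ w = ‖(g₁ - g - a) + a + (g - w)‖ := by rw [dist_eq_norm]; congr 1; abel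
      _ ≤ ‖g₁ - g - a‖ + ‖a‖ + ‖g - w‖ := by linarith [norm_add_le ((g₁ - g - a) + a) (g - w), norm_add_le (g₁ - g - a) a]
      _ ≤ ε / 2 + dist a 0 + G := by rw [← dist_eq_norm g w, ← dist_zero_right a]; linarith
      _ ≤ G + dist a 0 + ε := by linarith
  · rintro _ ⟨s₁, hs₁, rfl⟩ hsR
    beta_reduce at hsR ⊢
    rw [dist_zero_right] at hsR
    have hs₁0 : dist s₁ 0 ≤ dist a 0 + R + ε := by
      rw [dist_zero_right, dist_zero_right]
      calc ‖s₁‖ = ‖(s₁ - a) + a‖ := by congr 1; abel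
        _ ≤ ‖s₁ - a‖ + ‖a‖ := norm_add_le _ _
        _ ≤ ‖a‖ + R + ε := by linarith
    obtain ⟨s₂, hs₂, h⟩ := h1 s₁ hs₁ hs₁0
    refine ⟨s₂ - g₁, ⟨s₂, hs₂, rfl⟩, ?_⟩
    have e1 : ‖s₂ - g - s₁‖ ≤ ε / 2 := by rwa [← dist_eq_norm]
    calc dist (s₂ - g₁) (s₁ - a) = ‖(s₂ - g - s₁) - (g₁ - g - a)‖ := by rw [dist_eq_norm]; congr 1; abel
      _ ≤ ‖s₂ - g - s₁‖ + ‖g₁ - g - a‖ := norm_sub_le _ _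
      _ ≤ ε := by linarith
  · rintro _ ⟨s₂, hs₂, rfl⟩ hqR
    beta_reduce at hqR ⊢
    rw [dist_zero_right] at hqR
    have hs₂0 : dist (s₂ - g) 0 ≤ dist a 0 + R + ε := by
      rw [dist_zero_right, dist_zero_right]
      calc ‖s₂ - g‖ = ‖(s₂ - g₁) + (g₁ - g - a) + a‖ := by congr 1; abel
        _ ≤ ‖s₂ - g₁‖ + ‖g₁ - g - a‖ + ‖a‖ := by linarith [norm_add_le ((s₂ - g₁) + (g₁ - g - a)) a, norm_add_le (s₂ - g₁) (g₁ - g - a)]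
        _ ≤ ‖a‖ + R + ε := by linarith
    obtain ⟨s₃, hs₃, h⟩ := h2 s₂ hs₂ hs₂0
    refine ⟨s₃ - a, ⟨s₃, hs₃, rfl⟩, ?_⟩
    have e1 : ‖s₂ - g - s₃‖ ≤ ε / 2 := by rwa [← dist_eq_norm]
    calc dist (s₂ - g₁) (s₃ - a) = ‖(s₂ - g - s₃) - (g₁ - g - a)‖ := by rw [dist_eq_norm]; congr 1; abel
      _ ≤ ‖s₂ - g - s₃‖ + ‖g₁ - g - a‖ := norm_sub_le _ _
      _ ≤ ε := by linarith

/-! ## Uniformity of the gauge over centres -/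

/-- **Uniform repetitivity from rooted uniform recurrence.** For a separated `S` with `URS S`, for all `R ≥ 0`, `ε > 0`
there is ONE gauge `G` such that for every centre `a ∈ S` and every `w ∈ S` some `g ∈ S` with `dist g w ≤ G` has
`S − g` two-way `(ε, R)`-matched to `S − a`. (Compactness of separated sets under local matching + `urs_patch`.)
[folklore] -/
theorem urs_uniform {δ : ℝ} (hδ : 0 < δ) {S : Set (EuclideanSpace ℝ (Fin 3))}
    (hsep : ∀ p ∈ S, ∀ q ∈ S, p ≠ q → δ ≤ dist p q) (hU : URS S) (R ε : ℝ) (hR : 0 ≤ R) (hε : 0 < ε) :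
    ∃ G : ℝ, ∀ a ∈ S, ∀ w ∈ S, ∃ g ∈ S, dist g w ≤ G ∧
      BallMatch ε R 0 ((fun p => p - g) '' S) ((fun p => p - a) '' S) := by
  by_contra H
  push Not at H
  choose a ha w hw hbad using fun n : ℕ => H n
  set Ys : ℕ → Set (EuclideanSpace ℝ (Fin 3)) := fun k => (fun p => p - a k) '' S with hYs
  have hsepY : ∀ k, ∀ p ∈ Ys k, ∀ q ∈ Ys k, p ≠ q → δ ≤ dist p q := fun k => sep_image_sub hsep (a k)
  obtain ⟨φ, Y, hφ, -, hconv⟩ := exists_subseq_forall_eventually_ballMatch hδ Ys hsepY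
  set η : ℝ := min (ε / 4) (1 / 4) with hη_def
  have hη : 0 < η := lt_min (by linarith) (by norm_num)
  have hηε : η ≤ ε / 4 := min_le_left _ _
  have hη1 : η ≤ 1 / 4 := min_le_right _ _
  obtain ⟨N₀, hN₀⟩ := Filter.eventually_atTop.1 (hconv (R + 2) η hη)
  obtain ⟨G₀, hG₀⟩ := urs_patch hU (ha (φ N₀)) (R + 1) η (by linarith) hη
  set n : ℕ := max N₀ ⌈G₀⌉₊ with hn_def
  have hn : G₀ ≤ (φ n : ℝ) :=
    calc G₀ ≤ (⌈G₀⌉₊ : ℝ) := Nat.le_ceil _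
      _ ≤ (n : ℝ) := by exact_mod_cast le_max_right _ _
      _ ≤ (φ n : ℝ) := by exact_mod_cast hφ.id_le n
  obtain ⟨g, hg, hgw, hbm₁⟩ := hG₀ (w (φ n)) (hw (φ n))
  have hbm₂ : BallMatch η (R + 2) 0 ((fun p => p - a (φ N₀)) '' S) Y := hN₀ N₀ le_rfl
  have hbm₃ : BallMatch η (R + 2) 0 Y ((fun p => p - a (φ n)) '' S) := (hN₀ n (le_max_left _ _)).symm
  have h13 : BallMatch (η + η) (R + 1 / 2) 0 ((fun p => p - g) '' S) Y :=
    ballMatch_trans hbm₁ hbm₂ (by linarith) (by linarith) hη.le hη.le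
  have h14 : BallMatch (η + η + η) R 0 ((fun p => p - g) '' S) ((fun p => p - a (φ n)) '' S) :=
    ballMatch_trans h13 hbm₃ (by linarith) (by linarith) (by linarith) hη.le
  exact hbad (φ n) g hg (hgw.trans hn) (h14.mono (by linarith) le_rfl)

/-! ## Transfer to rooted local limits -/

/-- **Uniform recurrence is inherited by rooted local limits.** If `S` is separated with `URS S`, `c k ∈ S`, and the
re-rooted sets `S − c k` converge locally (two-way matched on every ball, to every tolerance, eventually) to `Z`, then
`URS Z`. [folklore] -/
theorem urs_of_limit {δ : ℝ} (hδ : 0 < δ) {S : Set (EuclideanSpace ℝ (Fin 3))}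
    (hsep : ∀ p ∈ S, ∀ q ∈ S, p ≠ q → δ ≤ dist p q) (hU : URS S) (c : ℕ → EuclideanSpace ℝ (Fin 3))
    (hc : ∀ k, c k ∈ S) {Z : Set (EuclideanSpace ℝ (Fin 3))}
    (hconv : ∀ R ε : ℝ, 0 < ε → ∀ᶠ k in atTop, BallMatch ε R 0 ((fun p => p - c k) '' S) Z) : URS Z := by
  intro R ε hε
  set R' : ℝ := max R 0 with hR'_def
  have hR' : 0 ≤ R' := le_max_right _ _
  have hRR' : R ≤ R' := le_max_left _ _
  set η : ℝ := min (ε / 4) (1 / 4) with hη_def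
  have hη : 0 < η := lt_min (by linarith) (by norm_num)
  have hηε : η ≤ ε / 4 := min_le_left _ _
  have hη1 : η ≤ 1 / 4 := min_le_right _ _
  obtain ⟨G, hG⟩ := urs_uniform hδ hsep hU (R' + 1) η (by linarith) hη
  have hG0 : 0 ≤ G := by
    obtain ⟨g', -, hg', -⟩ := hG (c 0) (hc 0) (c 0) (hc 0)
    exact dist_nonneg.trans hg'
  refine ⟨G + 1, fun w hw => ?_⟩
  set Rb : ℝ := dist w 0 + G + R' + 3 with hRb_def
  obtain ⟨k, hk⟩ := (hconv Rb η hη).exists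
  obtain ⟨_, ⟨s₁, hs₁, rfl⟩, hs₁w⟩ := hk.1 w hw (by rw [hRb_def]; linarith [dist_nonneg (x := w) (y := 0)])
  obtain ⟨g, hg, hgs₁, hbm⟩ := hG (c k) (hc k) s₁ hs₁
  have ew : ‖s₁ - c k - w‖ ≤ η := by rwa [← dist_eq_norm]
  have eg : ‖g - c k‖ ≤ G + dist w 0 + η := by
    calc ‖g - c k‖ = ‖(g - s₁) + (s₁ - c k - w) + w‖ := by congr 1; abel
      _ ≤ ‖g - s₁‖ + ‖s₁ - c k - w‖ + ‖w‖ := by linarith [norm_add_le ((g - s₁) + (s₁ - c k - w)) w, norm_add_le (g - s₁) (s₁ - c k - w)]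
      _ ≤ G + η + dist w 0 := by rw [← dist_eq_norm, ← dist_zero_right w]; linarith
      _ = G + dist w 0 + η := by ring
  obtain ⟨gZ, hgZ, hggZ⟩ := hk.2 (g - c k) ⟨g, hg, rfl⟩ (by rw [dist_zero_right, hRb_def]; linarith)
  have egZ : ‖g - c k - gZ‖ ≤ η := by rwa [← dist_eq_norm]
  refine ⟨gZ, hgZ, ?_, ?_, ?_⟩
  · calc dist gZ w = ‖(s₁ - c k - w) - (g - c k - gZ) + (g - s₁)‖ := by rw [dist_eq_norm]; congr 1; abel
      _ ≤ ‖s₁ - c k - w‖ + ‖g - c k - gZ‖ + ‖g - s₁‖ := by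
          linarith [norm_add_le ((s₁ - c k - w) - (g - c k - gZ)) (g - s₁), norm_sub_le (s₁ - c k - w) (g - c k - gZ)]
      _ ≤ η + η + G := by rw [← dist_eq_norm g s₁]; linarith
      _ ≤ G + 1 := by linarith
  · intro s hs hsR
    obtain ⟨_, ⟨s₂, hs₂, rfl⟩, h₂⟩ := hk.1 s hs (by rw [hRb_def]; linarith [dist_nonneg (x := w) (y := 0)])
    have e2 : ‖s₂ - c k - s‖ ≤ η := by rwa [← dist_eq_norm]
    have hs₂0 : dist (s₂ - c k) 0 ≤ R' + 1 := by
      rw [dist_zero_right] at hsR ⊢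
      calc ‖s₂ - c k‖ = ‖(s₂ - c k - s) + s‖ := by congr 1; abel
        _ ≤ ‖s₂ - c k - s‖ + ‖s‖ := norm_add_le _ _
        _ ≤ R' + 1 := by linarith
    obtain ⟨_, ⟨s₃, hs₃, rfl⟩, h₃⟩ := hbm.1 (s₂ - c k) ⟨s₂, hs₂, rfl⟩ hs₂0
    have e3 : ‖s₃ - g - (s₂ - c k)‖ ≤ η := by rwa [← dist_eq_norm]
    have hs₃0 : dist (s₃ - c k) 0 ≤ Rb := by
      rw [dist_zero_right] at hsR ⊢
      calc ‖s₃ - c k‖ = ‖(s₃ - g - (s₂ - c k)) + (s₂ - c k - s) + s + (g - c k)‖ := by congr 1; abel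
        _ ≤ ‖s₃ - g - (s₂ - c k)‖ + ‖s₂ - c k - s‖ + ‖s‖ + ‖g - c k‖ := norm_add₄_le _ _ _ _
        _ ≤ η + η + R' + (G + dist w 0 + η) := by linarith
        _ ≤ Rb := by rw [hRb_def]; linarith
    obtain ⟨z₃, hz₃, h₄⟩ := hk.2 (s₃ - c k) ⟨s₃, hs₃, rfl⟩ hs₃0
    have e4 : ‖s₃ - c k - z₃‖ ≤ η := by rwa [← dist_eq_norm]
    refine ⟨z₃, hz₃, ?_⟩
    calc dist (z₃ - gZ) s = ‖-(s₃ - c k - z₃) + (g - c k - gZ) + (s₃ - g - (s₂ - c k)) + (s₂ - c k - s)‖ := by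
          rw [dist_eq_norm]; congr 1; abel
      _ ≤ ‖-(s₃ - c k - z₃)‖ + ‖g - c k - gZ‖ + ‖s₃ - g - (s₂ - c k)‖ + ‖s₂ - c k - s‖ := norm_add₄_le _ _ _ _
      _ ≤ η + η + η + η := by rw [norm_neg]; linarith
      _ ≤ ε := by linarith
  · intro z hz hzR
    rw [dist_zero_right] at hzR
    have hz0 : dist z 0 ≤ Rb := by
      rw [dist_zero_right]
      calc ‖z‖ = ‖(z - gZ) - (g - c k - gZ) + (g - c k)‖ := by congr 1; abel
        _ ≤ ‖z - gZ‖ + ‖g - c k - gZ‖ + ‖g - c k‖ := by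
            linarith [norm_add_le ((z - gZ) - (g - c k - gZ)) (g - c k), norm_sub_le (z - gZ) (g - c k - gZ)]
        _ ≤ R' + η + (G + dist w 0 + η) := by linarith
        _ ≤ Rb := by rw [hRb_def]; linarith
    obtain ⟨_, ⟨s₂, hs₂, rfl⟩, h₂⟩ := hk.1 z hz hz0
    have e2 : ‖s₂ - c k - z‖ ≤ η := by rwa [← dist_eq_norm]
    have hs₂0 : dist (s₂ - g) 0 ≤ R' + 1 := by
      rw [dist_zero_right]
      calc ‖s₂ - g‖ = ‖(s₂ - c k - z) + (z - gZ) - (g - c k - gZ)‖ := by congr 1; abel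
        _ ≤ ‖s₂ - c k - z‖ + ‖z - gZ‖ + ‖g - c k - gZ‖ := by
            linarith [norm_sub_le ((s₂ - c k - z) + (z - gZ)) (g - c k - gZ), norm_add_le (s₂ - c k - z) (z - gZ)]
        _ ≤ R' + 1 := by linarith
    obtain ⟨_, ⟨s₃, hs₃, rfl⟩, h₃⟩ := hbm.2 (s₂ - g) ⟨s₂, hs₂, rfl⟩ hs₂0
    have e3 : ‖s₂ - g - (s₃ - c k)‖ ≤ η := by rwa [← dist_eq_norm]
    have hs₃0 : dist (s₃ - c k) 0 ≤ Rb := by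
      rw [dist_zero_right]
      calc ‖s₃ - c k‖ = ‖-(s₂ - g - (s₃ - c k)) + (s₂ - g)‖ := by congr 1; abel
        _ ≤ ‖-(s₂ - g - (s₃ - c k))‖ + ‖s₂ - g‖ := norm_add_le _ _
        _ ≤ η + (R' + 1) := by rw [norm_neg, ← dist_zero_right (s₂ - g)]; linarith
        _ ≤ Rb := by rw [hRb_def]; linarith [dist_nonneg (x := w) (y := 0)]
    obtain ⟨z₃, hz₃, h₄⟩ := hk.2 (s₃ - c k) ⟨s₃, hs₃, rfl⟩ hs₃0
    have e4 : ‖s₃ - c k - z₃‖ ≤ η := by rwa [← dist_eq_norm]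
    refine ⟨z₃, hz₃, ?_⟩
    calc dist (z - gZ) z₃ = ‖-(s₂ - c k - z) + (g - c k - gZ) + (s₂ - g - (s₃ - c k)) + (s₃ - c k - z₃)‖ := by
          rw [dist_eq_norm]; congr 1; abel
      _ ≤ ‖-(s₂ - c k - z)‖ + ‖g - c k - gZ‖ + ‖s₂ - g - (s₃ - c k)‖ + ‖s₃ - c k - z₃‖ := norm_add₄_le _ _ _ _
      _ ≤ η + η + η + η := by rw [norm_neg]; linarith
      _ ≤ ε := by linarith

end Summit.AtomisticToContinuum.Crystallization.Theorems.RepetitiveNetworkReductionEvaporationLaw
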